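import Mathlib

/-!
# SoloBlind — outer recursions of the ideal Görtler chain (PLATEAU, piece (PL-1′)(a))

The slow eigenvalue of the ideal chain satisfies, in the `m = 1` roll row,
`λ = -a₀ - K₀ + G_s + G_r` with `G_s = c s₁ / r₁` and `G_r = (3h/2) ρ₂ / r₁` (`ρ_m = iP r_m`).
The outer (leading-order) equations give `s₁ = -X r₁` with `X = hₓ/h` (mean-streak row) and,
for the even roll components driven by the alternating odd streak tail, the recursion
`((2i+3)/(2i+2)) ρ_{2i+2} + ((2i-1)/(2i)) ρ_{2i} = (-1)^i Y` with `Y = 2 c hₓ r₁ / h²`.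
We check (pure algebra): the particular solution `ρ_{2i} = (-1)^{i+1} (i/2) Y` solves the
recursion for every `i ≥ 1` (`rollParticular_solves`), it starts at `ρ₂ = Y/2`
(`rollParticular_one`), and with `s₁ = -X r₁`, `ρ₂ = Y/2` the two feedbacks add up to the
closed form: `G_s + G_r = c hₓ / (2h)` (`outerFeedback_closedForm`), i.e. `G_s = -c hₓ/h` and
`G_r = (3/2) c hₓ/h` (`outerFeedback_split`).
-/

namespace Summit.AnomalousDissipation.AnomalousDissipation.Theorems

/-- The particular solution of the even-roll outer recursion. -/
noncomputable def rollParticular (Y : ℝ) (i : ℕ) : ℝ := (-1) ^ (i + 1) * ((i : ℝ) / 2) * Y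

/-- It starts at `ρ₂ = Y/2` (`i = 1`). -/
theorem rollParticular_one (Y : ℝ) : rollParticular Y 1 = Y / 2 := by
  unfold rollParticular
  norm_num
  ring

/-- It solves `((2i+3)/(2i+2)) ρ_{2i+2} + ((2i-1)/(2i)) ρ_{2i} = (-1)^i Y` for all `i ≥ 1`. -/
theorem rollParticular_solves (Y : ℝ) (i : ℕ) (hi : 1 ≤ i) :
    ((2 * (i : ℝ) + 3) / (2 * (i : ℝ) + 2)) * rollParticular Y (i + 1)
      + ((2 * (i : ℝ) - 1) / (2 * (i : ℝ))) * rollParticular Y i = (-1) ^ i * Y := by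
  unfold rollParticular
  have hi' : (1 : ℝ) ≤ (i : ℝ) := by exact_mod_cast hi
  have h1 : (2 * (i : ℝ) + 2) ≠ 0 := by positivity
  have h2 : (2 * (i : ℝ)) ≠ 0 := by positivity
  have hpow : ((-1 : ℝ)) ^ (i + 1 + 1) = (-1) ^ i := by
    rw [pow_succ, pow_succ]
    ring
  have hpow1 : ((-1 : ℝ)) ^ (i + 1) = -((-1) ^ i) := by
    rw [pow_succ]
    ring
  push_cast
  rw [hpow, hpow1]
  field_simp
  ring

/-- With the outer values `s₁ = -X r₁`, `ρ₂ = Y/2`, `X = hₓ/h`, `Y = 2 c hₓ r₁ / h²`, the direct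
streak feedback and the roll-chain return are `-c hₓ/h` and `(3/2) c hₓ/h`. -/
theorem outerFeedback_split (c h hₓ r₁ s₁ ρ₂ X Y : ℝ) (hh : h ≠ 0) (hr : r₁ ≠ 0)
    (hX : X = hₓ / h) (hY : Y = 2 * c * hₓ * r₁ / h ^ 2)
    (hs : s₁ = -X * r₁) (hρ : ρ₂ = Y / 2) :
    c * s₁ / r₁ = -(c * hₓ / h) ∧ (3 * h / 2) * ρ₂ / r₁ = (3 / 2) * (c * hₓ / h) := by
  subst hs hρ
  subst hX hY
  constructor
  · field_simp
  · field_simp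
    try ring

/-- Hence the two outer feedbacks add up to the closed form `c hₓ / (2h)`:
`λ → -a₀ - K₀ + c hₓ/(2h) = α∞`. -/
theorem outerFeedback_closedForm (a₀ K₀ c h hₓ r₁ s₁ ρ₂ X Y : ℝ) (hh : h ≠ 0) (hr : r₁ ≠ 0)
    (hX : X = hₓ / h) (hY : Y = 2 * c * hₓ * r₁ / h ^ 2)
    (hs : s₁ = -X * r₁) (hρ : ρ₂ = Y / 2) :
    -a₀ - K₀ + c * s₁ / r₁ + (3 * h / 2) * ρ₂ / r₁ = -a₀ - K₀ + c * hₓ / (2 * h) := by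
  obtain ⟨h₁, h₂⟩ := outerFeedback_split c h hₓ r₁ s₁ ρ₂ X Y hh hr hX hY hs hρ
  rw [add_assoc, h₁, h₂]
  ring

end Summit.AnomalousDissipation.AnomalousDissipation.Theorems
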